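import Summits.SmoothPoincare4.SmoothPoincare4.Theorems.ConvexBisectionAcyclicBisectionExistsPageRotationSchedule
import Summits.SmoothPoincare4.SmoothPoincare4.Theorems.ConvexBisectionAcyclicBisectionExistsPrefixTransport
import Summits.SmoothPoincare4.SmoothPoincare4.Theorems.ConvexBisectionAcyclicBisectionExistsSplitComplement
import HarnessLib

/-!
# NF6 clause 5, T1 capstone: the prefix piece of a sorted fibred model is a Lefschetz handlebody
# of the prefix word (line `modp-braid-orbits`, crux `ConvexBisection.AcyclicBisectionExists`)

Support file for crux stmt-SmoothPoincare4-10508 (lead c5, cycle 1), namespace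
`Summit.SmoothPoincare4.SmoothPoincare4.Theorems.AcyclicBisectionExists.ModpBraidOrbits`.

In a sorted fibred model `M = X(F; P ++ N) ∪_Ψ Base g` Baykur's positive piece `X₊` is the base
with the `|P|` PREFIX handles attached (`helper_isMultiAttachment_split_append`, p129983;
`helper_exists_complement_of_split`, p131410, adds the complement piece `W₂` and the gluing
`M = X₁ ∪_φ W₂`).  The prefix attaching circles sit in the pages of directions
`pageDir (|P| + |N|) i`, whereas `IsLefschetzHandlebody g P X₁` asks for the standard directions
`pageDir |P| i`.  The page-rotation ambient isotopy of the base (`helper_exists_pageRotation`,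
p134450: pages to pages at every time, page `pageDir (m+n) i ↦ pageDir m i` at time `1`) and the
transport of the prefix link along it (`helper_isLefschetzHandlebody_of_split_of_rotation`, p134021:
shadows by homotopy invariance, page twistings by the fibred transport lemma, disjointness, and
`IsMultiAttachment.transport` for the same `X₁`) combine to the T1 statement of Report-r11-NF6 §2:

* `helper_isLefschetzHandlebody_of_split` — for a Lefschetz link `h` of `P ++ N` and ANY
  multi-attachment `X₁` of the base along the prefix sub-family, `IsLefschetzHandlebody g P X₁`
  (`|P| = 0`: the trivial isotopy; `|P| > 0`: the rotation);
* `helper_topologicalPackage_of_modelsOnFibred` — from `ModelsOnFibred M g (P ++ N)`: compact pieces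
  `X₁`, `W₂`, boundary data, a gluing `IsBoundaryGluing b₁ b₂ φ (𝓡 4) M` AND
  `IsLefschetzHandlebody g P X₁` — i.e. the two TOPOLOGICAL clauses (first and last) of the named fact
  `Literature.Geometry.Symplectic.steinRealisation_of_sorted_modelsOnFibred` (NF6), with the very
  pieces on which its Stein / open-book clauses are to be established (T3, S2, S3 of the report).

## References
* R. İ. Baykur, *Kähler decomposition of 4-manifolds*, AGT 6 (2006), proof of Thm. 5.1, pp. 13–14. [Baykur2006]
* R. E. Gompf, A. I. Stipsicz, *4-Manifolds and Kirby Calculus* (1999), §8.2. [GompfStipsiczGSM1999]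
-/

noncomputable section

set_option linter.dupNamespace false

open scoped Manifold ContDiff Topology
open Set Function

namespace Summit.SmoothPoincare4.SmoothPoincare4.Theorems.AcyclicBisectionExists.ModpBraidOrbits

open Literature.Topology.FourManifolds Literature.Topology.FourManifolds.LefschetzBase

/-- **T1 (Report-r11-NF6 §2): the prefix piece is a Lefschetz handlebody of the prefix word.**
For a Lefschetz link `h` realising `P ++ N` over `Base g` and any manifold `X₁` which is the base
with the `|P|` prefix handles attached, `IsLefschetzHandlebody g P X₁`: if `P = []` the link
conditions are vacuous (trivial isotopy), otherwise rotate the pages by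
`helper_exists_pageRotation g |P| |N|` and transport the prefix link
(`helper_isLefschetzHandlebody_of_split_of_rotation`). [cite: Baykur2006, proof of Thm. 5.1, pp. 13–14] -/
theorem helper_isLefschetzHandlebody_of_split :
    ∀ (g : ℕ) (P N : List ((Fin g ⊕ Fin g → ℤ) × Bool))
      (h : Fin (P ++ N).length →
        Literature.Topology.FourManifolds.HandleAttachingMap 3 2
          (Literature.Topology.FourManifolds.LefschetzBase.Base g))
      (X₁ : Type) [TopologicalSpace X₁] [ChartedSpace (EuclideanHalfSpace 4) X₁],
      Literature.Topology.FourManifolds.LefschetzBase.IsLefschetzLink g (P ++ N) h →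
      Literature.Topology.FourManifolds.HandleAttachingMap.IsMultiAttachment
        (fun i : Fin P.length => h (Fin.cast List.length_append.symm (Fin.castAdd N.length i)))
        (𝓡∂ 4) X₁ →
      Literature.Topology.FourManifolds.LefschetzBase.IsLefschetzHandlebody g P X₁ := by
  intro g P N h X₁ _ _ hl hX
  rcases Nat.eq_zero_or_pos P.length with hP | hP
  · -- no prefix handle: the trivial isotopy does (clause 3 is vacuous)
    refine helper_isLefschetzHandlebody_of_split_of_rotation g P N h X₁ hl hX
      ⟨AmbientIsotopy.refl, fun t c hc => ⟨c, hc, fun x hx => ?_⟩, fun i hi => absurd hi ?_⟩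
    · simpa using hx
    · omega
  · obtain ⟨R, -, h2, h3⟩ := helper_exists_pageRotation g P.length N.length hP
    exact helper_isLefschetzHandlebody_of_split_of_rotation g P N h X₁ hl hX ⟨R, h2, h3⟩

/-- **The topological package of NF6 (its clauses 1 and 5) for a sorted fibred model.**  From
`ModelsOnFibred M g (P ++ N)`: the prefix piece `X₁` (compact, Hausdorff, second countable),
the complement piece `W₂` (idem), boundary data `b₁`, `b₂`, a gluing diffeomorphism `φ` with
`IsBoundaryGluing b₁ b₂ φ (𝓡 4) M` (`helper_exists_complement_of_split`, p131410) and
`IsLefschetzHandlebody g P X₁` (`helper_isLefschetzHandlebody_of_split`).  What remains of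
`steinRealisation_of_sorted_modelsOnFibred` on these pieces is the Stein / open-book side
(T3: `W₂` is a positive Lefschetz handlebody of the dual word over the cap; S2: PALF ⇒ Stein
supported by the Kas open book; S3: orientation matching). [cite: Baykur2006, proof of Thm. 5.1, pp. 13–14] -/
theorem helper_topologicalPackage_of_modelsOnFibred :
    ∀ (M : Type) [TopologicalSpace M] [T2Space M] [SecondCountableTopology M]
      [ChartedSpace (EuclideanSpace ℝ (Fin 4)) M] [IsManifold (𝓡 4) ∞ M]
      (g : ℕ) (P N : List ((Fin g ⊕ Fin g → ℤ) × Bool)),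
      Literature.Topology.FourManifolds.LefschetzBase.ModelsOnFibred M g (P ++ N) →
      ∃ (X₁ : Type) (_ : TopologicalSpace X₁) (_ : ChartedSpace (EuclideanHalfSpace 4) X₁)
        (_ : IsManifold (𝓡∂ 4) ∞ X₁) (_ : CompactSpace X₁) (_ : T2Space X₁)
        (_ : SecondCountableTopology X₁)
        (W₂ : Type) (_ : TopologicalSpace W₂) (_ : ChartedSpace (EuclideanHalfSpace 4) W₂)
        (_ : IsManifold (𝓡∂ 4) ∞ W₂) (_ : CompactSpace W₂) (_ : T2Space W₂)
        (_ : SecondCountableTopology W₂)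
        (b₁ : Literature.Topology.FourManifolds.BoundaryData (𝓡∂ 4) X₁ (𝓡 3))
        (b₂ : Literature.Topology.FourManifolds.BoundaryData (𝓡∂ 4) W₂ (𝓡 3))
        (φ : b₁.carrier ≃ₘ⟮𝓡 3, 𝓡 3⟯ b₂.carrier),
        Literature.Topology.FourManifolds.IsBoundaryGluing b₁ b₂ φ (𝓡 4) M ∧
        Literature.Topology.FourManifolds.LefschetzBase.IsLefschetzHandlebody g P X₁ := by
  intro M _ _ _ _ _ g P N hM
  obtain ⟨h, X₁, _, _, _, _, _, _, D₁, W₂, _, _, _, _, _, _, b₁, b₂, φ, hlink, hglue⟩ :=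
    helper_exists_complement_of_split M g P N hM
  exact ⟨X₁, inferInstance, inferInstance, inferInstance, inferInstance, inferInstance, inferInstance,
    W₂, inferInstance, inferInstance, inferInstance, inferInstance, inferInstance, inferInstance,
    b₁, b₂, φ, hglue, helper_isLefschetzHandlebody_of_split g P N h X₁ hlink D₁.isMultiAttachment⟩

end Summit.SmoothPoincare4.SmoothPoincare4.Theorems.AcyclicBisectionExists.ModpBraidOrbits

end
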